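import Literature.NumberTheory.Automorphic.BinaryThetaPeriodicWeight
import Literature.NumberTheory.ModularForms.BinaryQuadGaussSumLattice
import Literature.NumberTheory.LFunctions.KloostermanPrimePower
import HarnessLib

/-!
# The binary theta series at a cusp: `θ_f(a/c + i/(c√r·y))` as a Gauss-sum-weighted theta series
# of the adjoint form on the lattice `s ∣ adj(M)w`

Topic `NumberTheory/Automorphic`, namespace `Literature.NumberTheory.Automorphic`; continues
`BinaryThetaPoisson.lean`, `BinaryThetaPeriodicWeight.lean` (Poisson summation with a periodic
weight) and `ModularForms/BinaryQuadGaussSumLattice.lean` (the twisted Gauss sums on and off the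
lattice). Theorem-only file (no definition, no named fact).

For an integral positive-definite form `f = (A,B,C)` of discriminant `−q` (`q` squarefree), a
cusp datum `c ≥ 1`, `a ā ≡ 1 (mod c)`, `s = (c, q)`, `r = q/s` (so `(r, c) = 1`), `r̄ = r⁻¹ mod c`,
`d = ā r̄`, and the theta series `θ_f(x, y) = Σ_{p∈ℤ²} e((x + iy)f(p))`:

* `tsum_cexp_binaryQF_cusp_eq_gaussSum_tsum` — Poisson at the cusp:
  `θ_f(a/c, Y) = (c²Y√q)⁻¹ Σ_{w∈ℤ²} G(a,c;f,w) e^{−2π f̃(w)/(c²Yq)}` (`f̃ = (C,−B,A)`,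
  `G = binQuadGaussSum`), from `tsum_periodic_mul_exp_neg_binaryQF` with the weight `e(a f(p)/c)`;
* `tsum_cexp_binaryQF_cusp_eq_lattice_tsum` — with the lattice structure of the Gauss sums
  (`binQuadGaussSum_eq_of_dvd_adj'`, `binQuadGaussSum_eq_zero_of_not_dvd_adj`):
  `θ_f(a/c, Y) = (c²Y√q)⁻¹ G(a,c;f,0) Σ_{w : s∣adj(M)w} e(−d·(f̃(w)/s)/c) e^{−2π (f̃(w)/s)/(c²Y r)}`;
* `binaryTheta_cusp_omega_relation` — the `ω`-RELATION SHAPE of Conrey–Iwaniec (3.3)–(3.4) at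
  weight one, class by class: for all `y > 0`,
  `(iy)⁻¹ θ_f(a/c, 1/(c√r·y)) = η_f · Σ_{w : s∣adj(M)w} e((−d/c + iy/(c√r))·(f̃(w)/s))`,
  `η_f = −i·G(a,c;f,0)/(c√s)` — the right-hand side is the theta series of the integral form
  `f̃/s` of discriminant `−q` on the index-`s` lattice `{w : s ∣ adj(M)w}` at the reflected point
  `x_B + iy/C`, `x_B = −d/c`, `C = c√r`, exactly as in `ConreyIwaniec2002.IsOmegaRelated`.
  (`|η_f| = 1` is `|G(a,c;f,0)| = c√s`, `ModularForms/BinaryQuadGaussSumValues.lean`; the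
  identification of `η_f` with `η₀(a,c,q)·ψ_s([f])` and of `(L_s, f̃/s)` with a form class are
  the arithmetic steps (3.15)/(3.17)–(3.18) of the source, not done here.)

Written for the cell `landau-siegel/ls-inputs` (line `theta-voronoi`, stub V1 `stub_theta_omega`:
the `ω`-transformation of the class-group theta series `θ(z;ψ) = ½Σ_Q ψ̄([𝔞_Q]) θ_Q(z)`).

## References

* B. Conrey, H. Iwaniec, Acta Arith. 103 (2002) 259–312, §3 (3.3)–(3.4), (3.14)–(3.18),
  Propositions 3.2–3.3 [ConreyIwaniec2002].
* R. C. Gunning, *Lectures on Modular Forms* (1962), §20, §22 Lemmas 4–5 (the same computation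
  for even forms at level `q`, `X ∈ 𝔖`) [Gunning1962].
-/

noncomputable section

open scoped Real FourierTransform
open Complex

namespace Literature.NumberTheory.Automorphic

open Literature.NumberTheory.QuadraticFields.Quadratic (BinQF)
open Literature.NumberTheory.ModularForms
open Literature.NumberTheory.LFunctions (sum_zmod_eq_sum_range)

/-! ## The Gauss sums as the finite Fourier coefficients of the weight `e(a f(p)/c)` -/

/-- `e(m) = 1` for an integer `m`. [folklore] -/
private theorem fourierChar_intCast_eq_one (m : ℤ) : (𝐞 (m : ℝ) : ℂ) = 1 := by
  rw [Real.fourierChar_apply]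
  have : ((2 * π * (m : ℝ) : ℝ) : ℂ) * I = (m : ℂ) * (2 * π * I) := by push_cast; ring
  rw [this]
  exact Complex.exp_int_mul_two_pi_mul_I m

/-- `e(m/c)·e(n/c) = stdAddChar((m + n) mod c)` for integers `m, n`: the additive character of
`ℝ` at rationals with denominator `c` is the standard additive character of `ℤ/c`. [folklore] -/
private theorem fourierChar_div_mul_fourierChar_div {c : ℕ} [NeZero c] (m n : ℤ) :
    (𝐞 ((m : ℝ) / c) : ℂ) * (𝐞 ((n : ℝ) / c) : ℂ) = (ZMod.stdAddChar (((m + n : ℤ)) : ZMod c) : ℂ) := by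
  rw [← Circle.coe_mul, ← AddChar.map_add_eq_mul, Real.fourierChar_apply, ZMod.stdAddChar_coe]
  congr 1
  push_cast
  ring

/-- **The bracket of `tsum_periodic_mul_exp_neg_binaryQF` for the weight `φ(p) = e(a f(p)/c)` is
the Gauss sum `G(a, c; f, w)`**:
`Σ_{μ,ν mod c} e(a f(μ,ν)/c) e((μw₁ + νw₂)/c) = binQuadGaussSum c f a w₁ w₂`.
[cite: ConreyIwaniec2002, §3 (3.16)–(3.21)] -/
theorem sum_fin_fourierChar_eval_eq_binQuadGaussSum {c : ℕ} [NeZero c] (f : BinQF) (a w₁ w₂ : ℤ) :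
    ∑ μ : Fin c, ∑ ν : Fin c,
        (𝐞 (((a * f.eval (μ : ℕ) (ν : ℕ) : ℤ) : ℝ) / c) : ℂ) *
          (𝐞 ((((μ : ℕ) * w₁ + (ν : ℕ) * w₂ : ℤ) : ℝ) / c) : ℂ) =
      binQuadGaussSum c f (a : ZMod c) (w₁ : ZMod c) (w₂ : ZMod c) := by
  rw [binQuadGaussSum_eq_sum_sum]
  rw [Fin.sum_univ_eq_sum_range (fun i : ℕ ↦ ∑ ν : Fin c,
        (𝐞 (((a * f.eval i (ν : ℕ) : ℤ) : ℝ) / c) : ℂ) *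
          (𝐞 ((((i : ℕ) * w₁ + (ν : ℕ) * w₂ : ℤ) : ℝ) / c) : ℂ)) c,
    sum_zmod_eq_sum_range]
  refine Finset.sum_congr rfl fun i _ ↦ ?_
  rw [Fin.sum_univ_eq_sum_range (fun j : ℕ ↦
        (𝐞 (((a * f.eval i j : ℤ) : ℝ) / c) : ℂ) *
          (𝐞 ((((i : ℕ) * w₁ + (j : ℕ) * w₂ : ℤ) : ℝ) / c) : ℂ)) c,
    sum_zmod_eq_sum_range]
  refine Finset.sum_congr rfl fun j _ ↦ ?_
  rw [fourierChar_div_mul_fourierChar_div]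
  congr 1
  rw [BinQF.eval]
  push_cast
  ring

/-! ## Poisson summation at the cusp `a/c` -/

/-- **`θ_f` at the cusp `a/c` by Poisson summation**: for `f = (A,B,C)` with `A > 0`,
`D = B² − 4AC < 0`, `c ≥ 1`, `a ∈ ℤ` and `Y > 0`,
`Σ_{p∈ℤ²} e((a/c + iY) f(p)) = (c²Y√|D|)⁻¹ Σ_{w∈ℤ²} G(a,c;f,w) e^{−2π f̃(w)/(c²Y|D|)}`,
`G = binQuadGaussSum`, `f̃(w) = Cw₁² − Bw₁w₂ + Aw₂²` (`tsum_periodic_mul_exp_neg_binaryQF` with the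
`c`-periodic weight `e(a f(p)/c)`, whose finite Fourier coefficients are the Gauss sums). This is
the source's `θ(ζ + a/c; ·) = Σ_{N mod c} e((a/c)A[N]) θ(c²ζ; N/c)` followed by the inversion
formula, before the Gauss sums are evaluated. [cite: Gunning1962, §22 Lemmas 4–5; §20] -/
theorem tsum_cexp_binaryQF_cusp_eq_gaussSum_tsum (f : BinQF) (hA : 0 < f.a) (hD : f.disc < 0)
    (c : ℕ) [NeZero c] (a : ℤ) {Y : ℝ} (hY : 0 < Y) :
    ∑' p : ℤ × ℤ, cexp (2 * π * I * ((a : ℂ) / c + I * Y) * (f.eval p.1 p.2 : ℤ)) =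
      (((c : ℝ) ^ 2 * Y * Real.sqrt ((4 * f.a * f.c - f.b ^ 2 : ℤ) : ℝ))⁻¹ : ℝ) *
        ∑' w : ℤ × ℤ, binQuadGaussSum c f (a : ZMod c) (w.1 : ZMod c) (w.2 : ZMod c) *
          (Real.exp (-(2 * π) / ((c : ℝ) ^ 2 * Y * ((4 * f.a * f.c - f.b ^ 2 : ℤ) : ℝ)) *
            ((f.c * w.1 ^ 2 - f.b * w.1 * w.2 + f.a * w.2 ^ 2 : ℤ) : ℝ)) : ℂ) := by
  have hc : 0 < c := Nat.pos_of_ne_zero (NeZero.ne c)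
  have hD' : f.b ^ 2 - 4 * f.a * f.c < 0 := by rw [BinQF.disc] at hD; exact hD
  -- the weight `φ(p) = e(a f(p)/c)` is `c`-periodic in each variable
  set φ : ℤ × ℤ → ℂ := fun p ↦ (𝐞 (((a * f.eval p.1 p.2 : ℤ) : ℝ) / c) : ℂ) with hφ
  have hφ_of_eq : ∀ (u v : ℤ) (m : ℤ), a * u = a * v + c * m →
      (𝐞 (((a * u : ℤ) : ℝ) / c) : ℂ) = (𝐞 (((a * v : ℤ) : ℝ) / c) : ℂ) := by
    intro u v m h
    have hc0 : (c : ℝ) ≠ 0 := by exact_mod_cast hc.ne'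
    have : ((a * u : ℤ) : ℝ) / c = ((a * v : ℤ) : ℝ) / c + (m : ℤ) := by
      rw [h]; push_cast; field_simp
    rw [this, AddChar.map_add_eq_mul, Circle.coe_mul, fourierChar_intCast_eq_one, mul_one]
  have hφ₁ : ∀ p : ℤ × ℤ, φ (p.1 + c, p.2) = φ p := by
    intro p
    simp only [hφ]
    refine hφ_of_eq _ _ (a * (f.a * (2 * p.1 + c) + f.b * p.2)) ?_
    simp only [BinQF.eval]; ring
  have hφ₂ : ∀ p : ℤ × ℤ, φ (p.1, p.2 + c) = φ p := by
    intro p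
    simp only [hφ]
    refine hφ_of_eq _ _ (a * (f.c * (2 * p.2 + c) + f.b * p.1)) ?_
    simp only [BinQF.eval]; ring
  have hmain := tsum_periodic_mul_exp_neg_binaryQF f.a f.b f.c hA hD' c hc φ hφ₁ hφ₂ hY
  -- the left-hand sides agree termwise
  have hL : ∀ p : ℤ × ℤ, cexp (2 * π * I * ((a : ℂ) / c + I * Y) * (f.eval p.1 p.2 : ℤ)) =
      φ p * (Real.exp (-(2 * π * Y) * ((f.a * p.1 ^ 2 + f.b * p.1 * p.2 + f.c * p.2 ^ 2 : ℤ) : ℝ)) : ℂ) := by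
    intro p
    simp only [hφ]
    rw [Real.fourierChar_apply, Complex.ofReal_exp, ← Complex.exp_add]
    congr 1
    rw [BinQF.eval]
    push_cast
    have hc0 : (c : ℂ) ≠ 0 := by exact_mod_cast hc.ne'
    field_simp
    ring_nf
    rw [I_sq]
    ring
  simp_rw [hL]
  rw [hmain]
  congr 1
  refine tsum_congr fun w ↦ ?_
  rw [sum_fin_fourierChar_eval_eq_binQuadGaussSum f a w.1 w.2]


/-! ## Arithmetic of the cusp datum `s = (c,q)`, `r = q/s` for squarefree `q` -/

/-- For squarefree `n` and `d ∣ n`: `(n/d, d) = 1`. [folklore] -/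
private theorem coprime_div_of_squarefree {n d : ℕ} (hn : Squarefree n) (hd : d ∣ n) :
    Nat.Coprime (n / d) d := by
  set g := Nat.gcd (n / d) d with hg
  have h1 : g ∣ n / d := Nat.gcd_dvd_left _ _
  have h2 : g ∣ d := Nat.gcd_dvd_right _ _
  have h3 : g * g ∣ n := by
    have : n / d * d = n := Nat.div_mul_cancel hd
    rw [← this]
    exact Nat.mul_dvd_mul h1 h2
  have hu := hn g h3
  rw [Nat.isUnit_iff] at hu
  exact hu

/-- The cusp datum: `s = (c, q) ≥ 1`, `s ∣ c`, `q = r·s`, `(r, s) = 1`, `(r, c) = 1` for `q`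
squarefree and `c ≥ 1` (`r = q/s`). [cite: ConreyIwaniec2002, §3 (3.16)] -/
theorem cusp_datum {q c : ℕ} (hq : Squarefree q) (hc : 0 < c) :
    0 < c.gcd q ∧ c.gcd q ∣ c ∧ q = q / c.gcd q * c.gcd q ∧
      Nat.Coprime (q / c.gcd q) (c.gcd q) ∧ Nat.Coprime (q / c.gcd q) c := by
  have hs0 : 0 < c.gcd q := Nat.gcd_pos_of_pos_left q hc
  have hsq : c.gcd q ∣ q := Nat.gcd_dvd_right c q
  have hrs : Nat.Coprime (q / c.gcd q) (c.gcd q) := coprime_div_of_squarefree hq hsq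
  refine ⟨hs0, Nat.gcd_dvd_left c q, (Nat.div_mul_cancel hsq).symm, hrs, ?_⟩
  -- `(r, c) ∣ (r, s) = 1`
  have hr : q / c.gcd q ∣ q := Nat.div_dvd_of_dvd hsq
  have h1 : Nat.gcd (q / c.gcd q) c ∣ c.gcd q :=
    Nat.dvd_gcd (Nat.gcd_dvd_right _ _) ((Nat.gcd_dvd_left _ _).trans hr)
  have h2 : Nat.gcd (q / c.gcd q) c ∣ Nat.gcd (q / c.gcd q) (c.gcd q) :=
    Nat.dvd_gcd (Nat.gcd_dvd_left _ _) h1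
  rw [hrs] at h2
  exact Nat.eq_one_of_dvd_one h2 |> fun h ↦ h

/-! ## The lattice form of the dual series -/

/-- **`θ_f` at the cusp `a/c`, with the Gauss sums evaluated on the lattice.** For `f = (A,B,C)`
positive definite of discriminant `−q`, `q` squarefree, `c ≥ 1`, `a ā ≡ 1 (mod c)`, `s = (c,q)`,
`r = q/s`, `r̄ = r⁻¹ mod c` and `Y > 0`:
`Σ_{p∈ℤ²} e((a/c + iY) f(p))
  = (c²Y√q)⁻¹ · G(a,c;f,0) · Σ_{w : s∣adj(M)w} e(−(ā r̄/c)·(f̃(w)/s)) e^{−2π f̃(w)/(c²Yq)}`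
(the Gauss sums vanish off the lattice `s ∣ adj(M)w` and equal `e(−ā r̄ f̃(w)/s /c)·G(a,c;f,0)`
on it: `BinaryQuadGaussSumLattice`). The phase is `e(−d·f'(w))` with `d = ā r̄` and `f' = f̃/s`
— the source's `d ≡ (ar)‾ (mod c)` of (3.16). [cite: ConreyIwaniec2002, §3 (3.14)–(3.18)] -/
theorem tsum_cexp_binaryQF_cusp_eq_lattice_tsum (f : BinQF) (hA : 0 < f.a) {q : ℕ}
    (hq : Squarefree q) (hdisc : f.disc = -(q : ℤ)) (c : ℕ) [NeZero c] (a abar : ℤ)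
    (hab : a * abar ≡ 1 [ZMOD c]) {Y : ℝ} (hY : 0 < Y) :
    ∑' p : ℤ × ℤ, cexp (2 * π * I * ((a : ℂ) / c + I * Y) * (f.eval p.1 p.2 : ℤ)) =
      (((c : ℝ) ^ 2 * Y * Real.sqrt q)⁻¹ : ℝ) *
        (binQuadGaussSum c f (a : ZMod c) 0 0 *
          ∑' w : ℤ × ℤ,
            if ((c.gcd q : ℕ) : ℤ) ∣ 2 * f.c * w.1 - f.b * w.2 ∧
                ((c.gcd q : ℕ) : ℤ) ∣ -f.b * w.1 + 2 * f.a * w.2 then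
              cexp (2 * π * I * (-((abar * ((((q / c.gcd q : ℕ) : ZMod c)⁻¹).val : ℤ) : ℤ) : ℂ) / c) *
                  ((BinQF.eval ⟨f.c, -f.b, f.a⟩ w.1 w.2 / (c.gcd q : ℕ) : ℤ) : ℂ)) *
                (Real.exp (-(2 * π) / ((c : ℝ) ^ 2 * Y * q) *
                  ((f.c * w.1 ^ 2 - f.b * w.1 * w.2 + f.a * w.2 ^ 2 : ℤ) : ℝ)) : ℂ)
            else 0) := by
  have hc : 0 < c := Nat.pos_of_ne_zero (NeZero.ne c)
  obtain ⟨hs0, hsc, hqrs, hcoprs, hcoprc⟩ := cusp_datum hq hc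
  set s : ℕ := c.gcd q with hs
  set r : ℕ := q / s with hr
  have hD : f.disc < 0 := by
    rw [hdisc]
    have : (0 : ℤ) < q := by
      have := hq.ne_zero
      exact_mod_cast Nat.pos_of_ne_zero this
    linarith
  have h4 : (4 * f.a * f.c - f.b ^ 2 : ℤ) = (q : ℤ) := by rw [BinQF.disc] at hdisc; linarith
  have hrs : 4 * f.a * f.c - f.b ^ 2 = (r : ℤ) * s := by
    rw [h4]; exact_mod_cast hqrs
  have hcop : IsCoprime (r : ℤ) (s : ℤ) := Nat.isCoprime_iff_coprime.mpr hcoprs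
  have haa : (a : ZMod c) * (abar : ZMod c) = 1 := by
    have := (ZMod.intCast_eq_intCast_iff _ _ c).mpr hab
    push_cast at this
    exact this
  have hrr : ((r : ℤ) : ZMod c) * ((r : ZMod c)⁻¹) = 1 := by
    push_cast
    exact ZMod.coe_mul_inv_eq_one r hcoprc
  have hsD : (s : ℤ) ∣ f.disc := by
    rw [hdisc]
    exact (Int.natCast_dvd_natCast.mpr (Nat.gcd_dvd_right c q)).neg_right
  -- step 1: Poisson at the cusp
  rw [tsum_cexp_binaryQF_cusp_eq_gaussSum_tsum f hA hD c a hY, h4]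
  simp only [Int.cast_natCast]
  congr 1
  rw [← tsum_mul_left]
  refine tsum_congr fun w ↦ ?_
  by_cases hw : (s : ℤ) ∣ 2 * f.c * w.1 - f.b * w.2 ∧ (s : ℤ) ∣ -f.b * w.1 + 2 * f.a * w.2
  · rw [if_pos hw, binQuadGaussSum_eq_of_dvd_adj' f hs0.ne' hrs hcop (a : ZMod c) (abar : ZMod c)
      ((r : ZMod c)⁻¹) haa hrr w.1 w.2 hw.1 hw.2]
    -- `stdAddChar` of an integer is `cexp`
    set E : ℤ := BinQF.eval ⟨f.c, -f.b, f.a⟩ w.1 w.2 / s with hE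
    set ri : ℕ := ((r : ZMod c)⁻¹).val with hri
    have h1 : (-((abar : ZMod c) * (r : ZMod c)⁻¹ * ((E : ℤ) : ZMod c))) =
        (((-(abar * (ri : ℤ)) * E : ℤ)) : ZMod c) := by
      push_cast
      rw [hri, ZMod.natCast_zmod_val]
      ring
    rw [h1, ZMod.stdAddChar_coe]
    push_cast
    ring_nf
  · rw [if_neg hw, binQuadGaussSum_eq_zero_of_not_dvd_adj f (hq.squarefree_of_dvd (Nat.gcd_dvd_right c q))
      hsc hsD (a : ZMod c) w.1 w.2 hw]
    simp


/-! ## The `ω`-relation shape (Conrey–Iwaniec (3.3)–(3.4)) class by class -/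

/-- `√q = √r·√s` and the two constants of the cusp transformation: with `C = c√r`,
`Y = 1/(Cy)`: `(c²Y√q)⁻¹ = y/(c√s)` and `2π·(sE)/(c²Yq) = 2π(y/C)·E`. [folklore] -/
private theorem cusp_constants {q r s c : ℕ} (hqrs : q = r * s) (hr : 0 < r) (hs : 0 < s)
    (hc : 0 < c) {y : ℝ} (hy : 0 < y) (E : ℝ) :
    ((c : ℝ) ^ 2 * (1 / ((c : ℝ) * Real.sqrt r * y)) * Real.sqrt q)⁻¹ = y / ((c : ℝ) * Real.sqrt s) ∧
      -(2 * π) / ((c : ℝ) ^ 2 * (1 / ((c : ℝ) * Real.sqrt r * y)) * q) * ((s : ℝ) * E) =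
        -(2 * π * (y / ((c : ℝ) * Real.sqrt r)) * E) := by
  have hq : (q : ℝ) = r * s := by exact_mod_cast hqrs
  have hsqrt : Real.sqrt q = Real.sqrt r * Real.sqrt s := by
    rw [hq, Real.sqrt_mul (Nat.cast_nonneg _)]
  have hr0 : (0 : ℝ) < Real.sqrt r := Real.sqrt_pos.mpr (by exact_mod_cast hr)
  have hs0 : (0 : ℝ) < Real.sqrt s := Real.sqrt_pos.mpr (by exact_mod_cast hs)
  have hc0 : (0 : ℝ) < c := by exact_mod_cast hc
  constructor
  · rw [hsqrt]
    field_simp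
  · set ρ : ℝ := Real.sqrt r with hρ
    have hrr : ρ * ρ = r := Real.mul_self_sqrt (Nat.cast_nonneg _)
    rw [hq, ← hrr]
    field_simp

/-- **The `ω`-relation (3.3)–(3.4) at weight one for a single binary theta series.** Let
`Q = (A,B,C)` be positive definite (`A > 0`) of discriminant `B² − 4AC = −q` with `q`
squarefree, `c ≥ 1`, `a ā ≡ 1 (mod c)`, `s = (c,q)`, `r = q/s`, `C = c√r`, `r̄ = r⁻¹ mod c`
(it exists: `(r,c) = 1`), `d = ā r̄`, `x_A = a/c`, `x_B = −d/c`. Then for every `y > 0`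
`(iy)⁻¹ · Σ_{p∈ℤ²} e((x_A + i/(Cy))·Q(p))
   = η_Q · Σ_{w∈ℤ², s∣adj(M)w} e((x_B + iy/C)·(Q̃(w)/s))`, `η_Q = −i·G(a,c;Q,0)/(c√s)`,
`Q̃ = (C,−B,A)`, `adj(M)w = (2Cw₁ − Bw₂, −Bw₁ + 2Aw₂)`, `G = binQuadGaussSum` — i.e. the
relation `ConreyIwaniec2002.IsOmegaRelated C η …` between `θ_Q` and the theta series of the
integral form `Q̃/s` (discriminant `−q`) on the index-`s` lattice `{s ∣ adj(M)w}`, written with the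
theta series in the binary-form normal form `Σ'_p cexp(2πi(x + yi)·Q(p))` of the tree's
`thetaValue_twistCount_eq_half_sum_binaryTheta`. (`|η_Q| = 1` is `|G(a,c;Q,0)| = c√s`; the
identification `η_Q = χ_s(a)·η₀(c,q)·ψ_s([Q])` and of `(lattice, Q̃/s)` with the class `[Q][𝔰]`
are (3.15)/(3.17)–(3.18) of the source.) [cite: ConreyIwaniec2002, §3 (3.3)–(3.4), (3.14)–(3.18)] -/
theorem binaryTheta_cusp_omega_relation (A B C : ℤ) (hA : 0 < A) {q : ℕ} (hq : Squarefree q)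
    (hdisc : B ^ 2 - 4 * A * C = -(q : ℤ)) (c : ℕ) [NeZero c] (a abar : ℤ)
    (hab : a * abar ≡ 1 [ZMOD c]) {y : ℝ} (hy : 0 < y) :
    (I * y)⁻¹ * ∑' p : ℤ × ℤ, cexp (2 * Real.pi * I *
        ((((a : ℝ) / c : ℝ) : ℂ) + (1 / ((c : ℝ) * Real.sqrt (q / c.gcd q : ℕ) * y) : ℝ) * I) *
        ((A * p.1 ^ 2 + B * p.1 * p.2 + C * p.2 ^ 2 : ℤ) : ℂ)) =
      (-I * binQuadGaussSum c ⟨A, B, C⟩ (a : ZMod c) 0 0 / ((c : ℝ) * Real.sqrt (c.gcd q : ℕ) : ℝ)) *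
      ∑' w : ℤ × ℤ,
        if ((c.gcd q : ℕ) : ℤ) ∣ 2 * C * w.1 - B * w.2 ∧ ((c.gcd q : ℕ) : ℤ) ∣ -B * w.1 + 2 * A * w.2 then
          cexp (2 * Real.pi * I *
            (((-((abar * ((((q / c.gcd q : ℕ) : ZMod c)⁻¹).val : ℤ) : ℤ) : ℝ) / c : ℝ) : ℂ) +
              (y / ((c : ℝ) * Real.sqrt (q / c.gcd q : ℕ)) : ℝ) * I) *
            (((C * w.1 ^ 2 - B * w.1 * w.2 + A * w.2 ^ 2) / (c.gcd q : ℕ) : ℤ) : ℂ))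
        else 0 := by
  have hc : 0 < c := Nat.pos_of_ne_zero (NeZero.ne c)
  obtain ⟨hs0, hsc, hqrs, hcoprs, hcoprc⟩ := cusp_datum hq hc
  set f : BinQF := ⟨A, B, C⟩ with hf
  have hr0 : 0 < q / c.gcd q := by
    rcases Nat.eq_zero_or_pos (q / c.gcd q) with h | h
    · exfalso; rw [h, zero_mul] at hqrs; exact hq.ne_zero hqrs
    · exact h
  have hC0 : 0 < (c : ℝ) * Real.sqrt (q / c.gcd q : ℕ) * y := by
    have : 0 < Real.sqrt (q / c.gcd q : ℕ) := Real.sqrt_pos.mpr (by exact_mod_cast hr0)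
    positivity
  have hY : 0 < 1 / ((c : ℝ) * Real.sqrt (q / c.gcd q : ℕ) * y) := by positivity
  have hdisc' : f.disc = -(q : ℤ) := by rw [hf, BinQF.disc]; exact hdisc
  have hrs : 4 * f.a * f.c - f.b ^ 2 = ((q / c.gcd q : ℕ) : ℤ) * (c.gcd q : ℕ) := by
    have h4 : (4 * f.a * f.c - f.b ^ 2 : ℤ) = (q : ℤ) := by rw [hf]; simp only; linarith
    rw [h4]; exact_mod_cast hqrs
  have hcop : IsCoprime ((q / c.gcd q : ℕ) : ℤ) ((c.gcd q : ℕ) : ℤ) :=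
    Nat.isCoprime_iff_coprime.mpr hcoprs
  have h2 := tsum_cexp_binaryQF_cusp_eq_lattice_tsum f hA hq hdisc' c a abar hab hY
  -- the left-hand sides agree termwise
  have hL : ∀ p : ℤ × ℤ, cexp (2 * Real.pi * I *
        ((((a : ℝ) / c : ℝ) : ℂ) + (1 / ((c : ℝ) * Real.sqrt (q / c.gcd q : ℕ) * y) : ℝ) * I) *
        ((A * p.1 ^ 2 + B * p.1 * p.2 + C * p.2 ^ 2 : ℤ) : ℂ)) =
      cexp (2 * π * I * ((a : ℂ) / c + I * (1 / ((c : ℝ) * Real.sqrt (q / c.gcd q : ℕ) * y) : ℝ)) *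
        (f.eval p.1 p.2 : ℤ)) := by
    intro p
    congr 1
    rw [hf, BinQF.eval]
    push_cast
    ring
  simp_rw [hL]
  rw [h2, ← mul_assoc, ← mul_assoc, ← tsum_mul_left, ← tsum_mul_left]
  refine tsum_congr fun w ↦ ?_
  obtain ⟨hK, hexp⟩ := cusp_constants hqrs hr0 hs0 hc hy
    (((C * w.1 ^ 2 - B * w.1 * w.2 + A * w.2 ^ 2) / (c.gcd q : ℕ) : ℤ) : ℝ)
  by_cases hw : ((c.gcd q : ℕ) : ℤ) ∣ 2 * C * w.1 - B * w.2 ∧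
      ((c.gcd q : ℕ) : ℤ) ∣ -B * w.1 + 2 * A * w.2
  · have hw' : ((c.gcd q : ℕ) : ℤ) ∣ 2 * f.c * w.1 - f.b * w.2 ∧
        ((c.gcd q : ℕ) : ℤ) ∣ -f.b * w.1 + 2 * f.a * w.2 := by
      rw [hf]; exact hw
    rw [if_pos hw', if_pos hw]
    -- `s ∣ Q̃(w)` on the lattice
    obtain ⟨u₁, hu₁⟩ := hw'.1
    obtain ⟨u₂, hu₂⟩ := hw'.2
    have hdvd := (dvd_adjEval_and_eval_eq f hs0.ne' hrs hcop w.1 w.2 u₁ u₂ hu₁ hu₂).1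
    have hev : BinQF.eval ⟨f.c, -f.b, f.a⟩ w.1 w.2 = C * w.1 ^ 2 - B * w.1 * w.2 + A * w.2 ^ 2 := by
      rw [hf, BinQF.eval]; ring
    rw [hev] at hdvd
    obtain ⟨E, hE⟩ := hdvd
    have hs0' : ((c.gcd q : ℕ) : ℤ) ≠ 0 := Int.natCast_ne_zero.mpr hs0.ne'
    have hEdiv : (C * w.1 ^ 2 - B * w.1 * w.2 + A * w.2 ^ 2) / ((c.gcd q : ℕ) : ℤ) = E := by
      rw [hE, Int.mul_ediv_cancel_left _ hs0']
    have hev' : BinQF.eval ⟨f.c, -f.b, f.a⟩ w.1 w.2 / ((c.gcd q : ℕ) : ℤ) = E := by rw [hev, hEdiv]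
    rw [hev', hEdiv, hE]
    rw [hEdiv] at hexp
    -- assemble the exponentials
    rw [Complex.ofReal_exp, show ((((c.gcd q : ℕ) : ℤ) * E : ℤ) : ℝ) = ((c.gcd q : ℕ) : ℝ) * (E : ℝ) by
        push_cast; ring, hexp, hK, ← Complex.exp_add]
    have hI : (I : ℂ)⁻¹ = -I := Complex.inv_I
    rw [mul_inv, hI]
    have hy0 : (y : ℂ) ≠ 0 := Complex.ofReal_ne_zero.mpr hy.ne'
    have hc0 : (c : ℂ) ≠ 0 := by exact_mod_cast hc.ne'
    have hsq0 : (Real.sqrt (c.gcd q : ℕ) : ℂ) ≠ 0 :=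
      Complex.ofReal_ne_zero.mpr (Real.sqrt_pos.mpr (by exact_mod_cast hs0)).ne'
    congr 1
    · push_cast
      field_simp
    · congr 1
      push_cast
      linear_combination (-(2 * (π : ℂ) * ((y : ℂ) / ((c : ℂ) * (Real.sqrt (q / c.gcd q : ℕ) : ℂ))) *
        (E : ℂ))) * Complex.I_sq
  · have hw' : ¬ (((c.gcd q : ℕ) : ℤ) ∣ 2 * f.c * w.1 - f.b * w.2 ∧
        ((c.gcd q : ℕ) : ℤ) ∣ -f.b * w.1 + 2 * f.a * w.2) := by
      rw [hf]; exact hw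
    rw [if_neg hw', if_neg hw, mul_zero, mul_zero]

end Literature.NumberTheory.Automorphic

end
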